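import Literature.AlgebraicGeometry.Deformation.FirstOrderDeformationRetractions
import Literature.AlgebraicGeometry.Deformation.MorphismLiftsSquareZeroSmoothAffine
import HarnessLib

/-!
# Retractions of a first-order deformation localize to principal opens

Layer `Literature/AlgebraicGeometry/Deformation` (cell hodgecm-mathlib, SOCKETS-F §4 (α) node E2-c/d, brick K2b; sequel of
`FirstOrderDeformationRetractions`). Setting as there: `k` a field, `X : Over (Spec k)`, `f : X' ⟶ Spec k[ε]`, `i : X ⟶ X'`
the closed fibre (`IsPullback i X.hom f (Spec (k[ε] → k))`), `t = ε · 1`. A ring-level retraction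
`σ : Γ(i⁻¹V, 𝒪_X) → Γ(V, 𝒪_{X'})` over an affine open `V` does not restrict to an arbitrary smaller open, but it DOES
restrict, uniquely, to every PRINCIPAL open `W = D(b) ⊆ V` (`b ∈ Γ(V, 𝒪_{X'})`): `Γ(i⁻¹W, 𝒪_X) = Γ(i⁻¹V, 𝒪_X)_{i♯b}` is a
localisation (`i⁻¹D(b) = D(i♯ b)`), and `σ(i♯ b)|_W = b|_W + (t · c)|_W` is a unit plus a nilpotent, hence a unit:

* `existsUnique_retraction_restrict_of_eq_basicOpen` — the unique ring map `τ : Γ(i⁻¹W, 𝒪_X) → Γ(W, 𝒪_{X'})` with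
  `σ(a)|_W = τ(a|_W)`;
* `app_eq_self_of_restrict`, `map_constToPresheaf_of_restrict` (and the `_eq_flatSecStructureMap_` / `_eq_` variants) —
  such a `τ` is again a retraction, with the restricted values on the constants;
* `ringHom_ext_of_eq_basicOpen`, `retraction_restrict_unique` — ring maps out of `Γ(i⁻¹W, 𝒪_X)` are determined on the
  restrictions from `Γ(i⁻¹V, 𝒪_X)`;
* `exists_retraction_of_smooth` — for `X → Spec k` SMOOTH, retractions exist over every affine open (★
  `Deformation/MorphismLiftsSquareZeroSmoothAffine.formallySmooth_sections_of_smooth` + `FirstOrderDeformationRetractions`'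
  `exists_retraction_of_formallySmooth`).

This is what makes the Čech bookkeeping of the Kodaira–Spencer cocycle run at ring level on an affine open cover whose
pairwise intersections are principal in the members (e.g. the standard cover of a projective embedding, Hartshorne II.5 /
the tree's `Morphisms.exists_isAffineOpen_cover_inf_eq_basicOpen_of_isProjectiveOver`). Theorems only; no definitions.

## References

* [Hartshorne2010] R. Hartshorne, *Deformation Theory*, GTM 257 (2010): Thm. 5.3 and proof, pp. 38–39 («on
  `U_ij = U_i ∩ U_j` we get an automorphism `ψ_ij = φ_j⁻¹ φ_i` of `U_ij ×_k D`» — restriction of the local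
  trivialisations to the intersections); Cor. 4.8 (p. 30).
* [Hartshorne1977] R. Hartshorne, *Algebraic Geometry*, GTM 52 (1977): II.2 Prop. 2.2 (b) (`𝒪(D(f)) = A_f`), II Ex. 2.16 (a)
  (`f⁻¹(D(r)) = D(f♯ r)`).
-/

noncomputable section

-- `TopCat.Presheaf`/`TopCat.Sheaf` are not reducible (as in Mathlib's `AlgebraicGeometry/Modules`).
set_option backward.isDefEq.respectTransparency false

open CategoryTheory AlgebraicGeometry Opposite TopologicalSpace
open TrivSqZeroExt DualNumber

universe u

namespace Literature.AlgebraicGeometry.Deformation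

open Literature.AlgebraicGeometry.HodgeTheory Literature.AlgebraicGeometry.Modules
  Literature.AlgebraicGeometry.Motives

variable {k : Type u} [Field k] {X : Over (Spec (CommRingCat.of k))} {X' : Scheme.{u}}
  (f : X' ⟶ Spec (.of k[ε])) {i : X.left ⟶ X'}
  (Hi : IsPullback i X.hom f (Spec.map (CommRingCat.ofHom (fstHom k k k).toRingHom)))

/-- The structure constants restrict: `(s · 1)|_W = s · 1`. [folklore] -/
private theorem map_constToPresheaf_app {U W : X.left.Opens} (h : W ≤ U) (s : k) :
    X.left.presheaf.map (homOfLE h).op ((constToPresheaf X).app (op U) s) = (constToPresheaf X).app (op W) s := by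
  change (X.left.presheaf.map (homOfLE (le_top : U ≤ ⊤)).op ≫ X.left.presheaf.map (homOfLE h).op) _ =
    X.left.presheaf.map (homOfLE (le_top : W ≤ ⊤)).op _
  rw [← X.left.presheaf.map_comp]
  rfl

include Hi in
/-- **A retraction over an affine `V` restricts uniquely to every principal open `W = D(b) ⊆ V`**: there is a unique
ring map `τ : Γ(i⁻¹W, 𝒪_X) → Γ(W, 𝒪_{X'})` with `σ(a)|_W = τ(a|_W)` (`Γ(i⁻¹W, 𝒪_X)` is the localisation of
`Γ(i⁻¹V, 𝒪_X)` at `i♯ b`, and `σ(i♯ b)|_W = b|_W + (t·c)|_W` is invertible).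
[cite: Hartshorne2010, Thm. 5.3 (proof), p. 38] [cite: Hartshorne1977, II.2 Prop. 2.2 (b) and II Ex. 2.16 (a)] -/
theorem existsUnique_retraction_restrict_of_eq_basicOpen (V : X'.affineOpens) (b : Γ(X', V.1)) {W : X'.Opens}
    (hW : W = X'.basicOpen b) (hWV : W ≤ V.1)
    (σ : Γ(X.left, i ⁻¹ᵁ V.1) →+* Γ(X', V.1)) (hσ : ∀ a, i.app V.1 (σ a) = a) :
    ∃! τ : Γ(X.left, i ⁻¹ᵁ W) →+* Γ(X', W),
      ∀ a, X'.presheaf.map (homOfLE hWV).op (σ a) = τ (X.left.presheaf.map (homOfLE (i.preimage_mono hWV)).op a) := by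
  subst hW
  have hU : IsAffineOpen (i ⁻¹ᵁ V.1) := isAffineOpen_preimage_fibre_dualNumber f Hi V
  -- `Γ(i⁻¹D(b), 𝒪_X)` is the localisation of `Γ(i⁻¹V, 𝒪_X)` at `i♯ b`
  letI alg : Algebra Γ(X.left, i ⁻¹ᵁ V.1) Γ(X.left, i ⁻¹ᵁ X'.basicOpen b) :=
    (X.left.presheaf.map (homOfLE (i.preimage_mono hWV)).op).hom.toAlgebra
  haveI hloc : IsLocalization.Away (i.app V.1 b) Γ(X.left, i ⁻¹ᵁ X'.basicOpen b) :=
    hU.isLocalization_of_eq_basicOpen (i.app V.1 b) (homOfLE (i.preimage_mono hWV)) (Scheme.preimage_basicOpen i b)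
  have halg : ∀ a, algebraMap Γ(X.left, i ⁻¹ᵁ V.1) Γ(X.left, i ⁻¹ᵁ X'.basicOpen b) a =
      X.left.presheaf.map (homOfLE (i.preimage_mono hWV)).op a := fun _ => rfl
  -- the target map `res ∘ σ` sends `i♯ b` to a unit (unit `b|` plus the nilpotent `(t·c)|`)
  let g : Γ(X.left, i ⁻¹ᵁ V.1) →+* Γ(X', X'.basicOpen b) := (X'.presheaf.map (homOfLE hWV).op).hom.comp σ
  have hg : ∀ a, g a = X'.presheaf.map (homOfLE hWV).op (σ a) := fun _ => rfl
  have hunit : IsUnit (g (i.app V.1 b)) := by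
    obtain ⟨c, hc⟩ := exists_eq_sectionOn_param_mul f Hi V (σ (i.app V.1 b) - b) (by rw [map_sub, hσ, sub_self])
    rw [sub_eq_iff_eq_add'] at hc
    rw [hg, hc, map_add]
    refine IsNilpotent.isUnit_add_left_of_commute ⟨2, ?_⟩ ?_ (Commute.all _ _)
    · rw [← map_pow, pow_two, mul_mul_mul_comm, sectionOn_param_mul_self, zero_mul, map_zero]
    · have e : homOfLE hWV = homOfLE (X'.basicOpen_le b) := Subsingleton.elim _ _
      rw [e]
      exact RingedSpace.isUnit_res_basicOpen (X := X'.toLocallyRingedSpace.toRingedSpace) b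
  refine ⟨IsLocalization.Away.lift (i.app V.1 b) hunit, fun a => ?_, fun τ hτ => ?_⟩
  · rw [← halg, IsLocalization.Away.lift_eq, hg]
  · refine (IsLocalization.ringHom_ext (Submonoid.powers (i.app V.1 b)) (RingHom.ext fun a => ?_)).symm
    rw [RingHom.comp_apply, RingHom.comp_apply, IsLocalization.Away.lift_eq, hg, halg, hτ a]

include Hi in
/-- The restricted map is again a retraction: `i♯ ∘ τ = id` (both sides agree on `Γ(i⁻¹V, 𝒪_X)`, which generates the
localisation). [cite: Hartshorne2010, Thm. 5.3 (proof), p. 38] [cite: Hartshorne1977, II.2 Prop. 2.2 (b)] -/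
theorem app_eq_self_of_restrict (V : X'.affineOpens) (b : Γ(X', V.1)) {W : X'.Opens} (hW : W = X'.basicOpen b)
    (hWV : W ≤ V.1) {σ : Γ(X.left, i ⁻¹ᵁ V.1) →+* Γ(X', V.1)} (hσ : ∀ a, i.app V.1 (σ a) = a)
    {τ : Γ(X.left, i ⁻¹ᵁ W) →+* Γ(X', W)}
    (hτ : ∀ a, X'.presheaf.map (homOfLE hWV).op (σ a) = τ (X.left.presheaf.map (homOfLE (i.preimage_mono hWV)).op a))
    (a' : Γ(X.left, i ⁻¹ᵁ W)) : i.app W (τ a') = a' := by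
  subst hW
  have hU : IsAffineOpen (i ⁻¹ᵁ V.1) := isAffineOpen_preimage_fibre_dualNumber f Hi V
  letI alg : Algebra Γ(X.left, i ⁻¹ᵁ V.1) Γ(X.left, i ⁻¹ᵁ X'.basicOpen b) :=
    (X.left.presheaf.map (homOfLE (i.preimage_mono hWV)).op).hom.toAlgebra
  haveI hloc : IsLocalization.Away (i.app V.1 b) Γ(X.left, i ⁻¹ᵁ X'.basicOpen b) :=
    hU.isLocalization_of_eq_basicOpen (i.app V.1 b) (homOfLE (i.preimage_mono hWV)) (Scheme.preimage_basicOpen i b)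
  have key : ((i.app (X'.basicOpen b)).hom.comp τ) = RingHom.id _ := by
    refine IsLocalization.ringHom_ext (Submonoid.powers (i.app V.1 b)) (RingHom.ext fun a => ?_)
    rw [RingHom.comp_apply, RingHom.comp_apply, RingHom.id_comp]
    change i.app _ (τ (X.left.presheaf.map (homOfLE (i.preimage_mono hWV)).op a)) = _
    rw [← hτ a, ← CommRingCat.comp_apply, Scheme.Hom.naturality, CommRingCat.comp_apply, hσ]
    rfl
  exact RingHom.congr_fun key a'

/-- The restricted retraction has the restricted values on the constants. [cite: Hartshorne2010, Thm. 5.3 (proof), p. 38] -/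
theorem map_constToPresheaf_of_restrict (V : X'.affineOpens) {W : X'.Opens} (hWV : W ≤ V.1)
    {σ : Γ(X.left, i ⁻¹ᵁ V.1) →+* Γ(X', V.1)} {τ : Γ(X.left, i ⁻¹ᵁ W) →+* Γ(X', W)}
    (hτ : ∀ a, X'.presheaf.map (homOfLE hWV).op (σ a) = τ (X.left.presheaf.map (homOfLE (i.preimage_mono hWV)).op a))
    (s : k) :
    τ ((constToPresheaf X).app (op (i ⁻¹ᵁ W)) s) =
      X'.presheaf.map (homOfLE hWV).op (σ ((constToPresheaf X).app (op (i ⁻¹ᵁ V.1)) s)) := by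
  rw [hτ, map_constToPresheaf_app]

/-- If `σ` has the absolute constants `t_V(ι s)`, so has its restriction. [cite: Hartshorne2010, Thm. 5.3 (proof), p. 38] -/
theorem map_constToPresheaf_eq_flatSecStructureMap_of_restrict (V : X'.affineOpens) {W : X'.Opens} (hWV : W ≤ V.1)
    {σ : Γ(X.left, i ⁻¹ᵁ V.1) →+* Γ(X', V.1)} {τ : Γ(X.left, i ⁻¹ᵁ W) →+* Γ(X', W)}
    (hτ : ∀ a, X'.presheaf.map (homOfLE hWV).op (σ a) = τ (X.left.presheaf.map (homOfLE (i.preimage_mono hWV)).op a))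
    (hσk : ∀ s : k, σ ((constToPresheaf X).app (op (i ⁻¹ᵁ V.1)) s) = flatSecStructureMap f V.1 (inl s)) (s : k) :
    τ ((constToPresheaf X).app (op (i ⁻¹ᵁ W)) s) = flatSecStructureMap f W (inl s) := by
  rw [map_constToPresheaf_of_restrict V hWV hτ, hσk, flatSecStructureMap_apply, flatSecStructureMap_apply,
    ← CommRingCat.comp_apply, ← X'.presheaf.map_comp]
  rfl

/-- Two retractions over `W` compatible with retractions `σ, σ'` over `V ⊇ W` having the same constants have the same
constants. [cite: Hartshorne2010, Thm. 5.3 (proof), p. 38] -/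
theorem map_constToPresheaf_eq_of_restrict (V : X'.affineOpens) {W : X'.Opens} (hWV : W ≤ V.1)
    {σ σ' : Γ(X.left, i ⁻¹ᵁ V.1) →+* Γ(X', V.1)} {τ τ' : Γ(X.left, i ⁻¹ᵁ W) →+* Γ(X', W)}
    (hτ : ∀ a, X'.presheaf.map (homOfLE hWV).op (σ a) = τ (X.left.presheaf.map (homOfLE (i.preimage_mono hWV)).op a))
    (hτ' : ∀ a, X'.presheaf.map (homOfLE hWV).op (σ' a) = τ' (X.left.presheaf.map (homOfLE (i.preimage_mono hWV)).op a))
    (hconst : ∀ s : k, σ' ((constToPresheaf X).app (op (i ⁻¹ᵁ V.1)) s) = σ ((constToPresheaf X).app (op (i ⁻¹ᵁ V.1)) s))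
    (s : k) :
    τ' ((constToPresheaf X).app (op (i ⁻¹ᵁ W)) s) = τ ((constToPresheaf X).app (op (i ⁻¹ᵁ W)) s) := by
  rw [map_constToPresheaf_of_restrict V hWV hτ, map_constToPresheaf_of_restrict V hWV hτ', hconst]

include Hi in
/-- **Ring maps out of `Γ(i⁻¹W, 𝒪_X)`, `W = D(b) ⊆ V` principal, are determined on the restrictions from `Γ(i⁻¹V, 𝒪_X)`**
(a localisation). [cite: Hartshorne1977, II.2 Prop. 2.2 (b) and II Ex. 2.16 (a)] -/
theorem ringHom_ext_of_eq_basicOpen (V : X'.affineOpens) (b : Γ(X', V.1)) {W : X'.Opens} (hW : W = X'.basicOpen b)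
    (hWV : W ≤ V.1) {R : Type*} [CommRing R] {φ ψ : Γ(X.left, i ⁻¹ᵁ W) →+* R}
    (h : ∀ a, φ (X.left.presheaf.map (homOfLE (i.preimage_mono hWV)).op a) =
      ψ (X.left.presheaf.map (homOfLE (i.preimage_mono hWV)).op a)) : φ = ψ := by
  subst hW
  have hU : IsAffineOpen (i ⁻¹ᵁ V.1) := isAffineOpen_preimage_fibre_dualNumber f Hi V
  letI alg : Algebra Γ(X.left, i ⁻¹ᵁ V.1) Γ(X.left, i ⁻¹ᵁ X'.basicOpen b) :=
    (X.left.presheaf.map (homOfLE (i.preimage_mono hWV)).op).hom.toAlgebra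
  haveI hloc : IsLocalization.Away (i.app V.1 b) Γ(X.left, i ⁻¹ᵁ X'.basicOpen b) :=
    hU.isLocalization_of_eq_basicOpen (i.app V.1 b) (homOfLE (i.preimage_mono hWV)) (Scheme.preimage_basicOpen i b)
  exact IsLocalization.ringHom_ext (Submonoid.powers (i.app V.1 b)) (RingHom.ext fun a => h a)

include Hi in
/-- Two retractions over a principal `W = D(b) ⊆ V` compatible with the same retraction over `V` are equal.
[cite: Hartshorne2010, Thm. 5.3 (proof), p. 38] -/
theorem retraction_restrict_unique (V : X'.affineOpens) (b : Γ(X', V.1)) {W : X'.Opens} (hW : W = X'.basicOpen b)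
    (hWV : W ≤ V.1) {σ : Γ(X.left, i ⁻¹ᵁ V.1) →+* Γ(X', V.1)} {τ τ₁ : Γ(X.left, i ⁻¹ᵁ W) →+* Γ(X', W)}
    (hτ : ∀ a, X'.presheaf.map (homOfLE hWV).op (σ a) = τ (X.left.presheaf.map (homOfLE (i.preimage_mono hWV)).op a))
    (hτ₁ : ∀ a, X'.presheaf.map (homOfLE hWV).op (σ a) = τ₁ (X.left.presheaf.map (homOfLE (i.preimage_mono hWV)).op a)) :
    τ = τ₁ :=
  ringHom_ext_of_eq_basicOpen f Hi V b hW hWV fun a => by rw [← hτ a, hτ₁ a]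

/-! ### Smooth `X`: the affine pieces are formally smooth, so retractions exist locally -/

include Hi in
/-- **Local existence of retractions for smooth `X`**: over every affine open `V` of `X'` there is a retraction with the
scheme's constants. [cite: Hartshorne2010, Cor. 4.8 (p. 30) and Thm. 5.3 (proof), p. 38 («the induced deformation `U'_i` is trivial by (4.8)»)] -/
theorem exists_retraction_of_smooth [Smooth X.hom] (V : X'.affineOpens) :
    ∃ σ : Γ(X.left, i ⁻¹ᵁ V.1) →+* Γ(X', V.1), (∀ a, i.app V.1 (σ a) = a) ∧
      ∀ s : k, σ ((constToPresheaf X).app (op (i ⁻¹ᵁ V.1)) s) = flatSecStructureMap f V.1 (inl s) := by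
  letI alg : Algebra k Γ(X.left, i ⁻¹ᵁ V.1) :=
    ((Scheme.ΓSpecIso (.of k)).inv ≫ X.hom.appLE ⊤ (i ⁻¹ᵁ V.1) le_top).hom.toAlgebra
  haveI := formallySmooth_sections_of_smooth X.hom (isAffineOpen_preimage_fibre_dualNumber f Hi V)
  exact exists_retraction_of_formallySmooth f Hi V (fun _ => rfl)

end Literature.AlgebraicGeometry.Deformation

end
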